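import Summits.CriticalPhenomena.PercolationContinuityZ3.Theorems.PercNearOneGluingNoHeavyQuantFarBundleLaw
import Summits.CriticalPhenomena.PercolationContinuityZ3.Theorems.PercNearOneGluingNoHeavyQuantFarBundleDichotomy
import Summits.CriticalPhenomena.PercolationContinuityZ3.Theorems.PercNearOneGluingAdditiveGluingVariants2083
import HarnessLib

/-!
# QUANT lane R8, front "FAR beyond trees", layer one — the BUNDLE DICHOTOMY, graph side IIIa: the law of the number of open leaf pairs

builds on p205010 (kernel theorem, internal audit signed; external expert review pending)

Support file (`--supports stmt-CriticalPhenomena-4575`), seat `prim-quant-p1` (gen 18); memo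
`run/shared/lean/prim/quant/prim-quant-p1-g18/FOR-LEAD-UNICYCLIC-TREES.md` §1 (kernel plan §6, file F-B part 3a).
Standard axioms; no sorries; no definitions.

* generic helpers: `Bundle.determinedBy_of_mem_iff`, `real_mem_inter` / `real_notMem_inter` (one independent pair
  in front of an event determined by other pairs), `real_congr_of_null` (a weight-`0` pair is a.s. closed);
* `Bundle.real_count_zero_eq` / `real_count_one_eq` / `real_count_ge_one_eq` / `real_count_ge_two_eq` — for the number `K_L` of open leaf
  pairs `s(u,ℓ)`, `ℓ ∈ L ∌ u`: `P(K_L = 0) = Bundle.z0 L q`, `P(K_L = 1) = Bundle.z1 L q`, `P(K_L ≥ 1) = 1 − z0`, `P(K_L ≥ 2) = 1 − z0 − z1`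
  with `q ℓ = v s(u,ℓ)` (the algebraic `z0`, `z1` of `…QuantFarBundleDichotomy`).
[cite: Grimmett1999, §1.3 p. 10; §2.2] (product measure, cylinder events); bookkeeping [this work].
-/

noncomputable section

namespace Summit.CriticalPhenomena.PercolationContinuityZ3.Theorems

namespace Quant

namespace Bundle

open Finset MeasureTheory Set
open Literature.Probability.LatticeModels
open Literature.Probability.Percolation
open scoped Classical

variable {n : ℕ}

/-! ## Generic helpers: determinacy by a finset of pairs, one-pair independence, one null pair -/

/-- An event whose membership depends only on the memberships of the pairs in `F` is determined by `F`. [folklore] -/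
theorem determinedBy_of_mem_iff {S : Set (BondConfig (Fin n))} {F : Finset (Sym2 (Fin n))}
    (h : ∀ ω ω' : BondConfig (Fin n), (∀ e ∈ F, e ∈ ω ↔ e ∈ ω') → (ω ∈ S ↔ ω' ∈ S)) :
    DeterminedBy S (↑F : Set (Sym2 (Fin n))) := by
  rw [determinedBy_iff]
  intro ω ω' hF
  refine h ω ω' fun e he => ?_
  constructor
  · intro hω; exact (((Set.ext_iff.1 hF) e).1 ⟨hω, Finset.mem_coe.2 he⟩).1
  · intro hω; exact (((Set.ext_iff.1 hF) e).2 ⟨hω, Finset.mem_coe.2 he⟩).1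

/-- One open pair in front of an independent event: `P({e ∈ ω} ∩ S) = v e · P(S)` for `S` determined by `F ∌ e`. [folklore] -/
theorem real_mem_inter (v : Sym2 (Fin n) → unitInterval) (e : Sym2 (Fin n)) {F : Finset (Sym2 (Fin n))} (heF : e ∉ F)
    {S : Set (BondConfig (Fin n))} (hS : DeterminedBy S (↑F : Set (Sym2 (Fin n)))) :
    (prodBernoulli v).real ({ω | e ∈ ω} ∩ S) = (v e : ℝ) * (prodBernoulli v).real S := by
  have hmeas : ∀ U : Set (BondConfig (Fin n)), MeasurableSet U := fun U => (Set.toFinite U).measurableSet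
  rw [prodBernoulli_real_inter_of_determinedBy_disjoint v (Finset.disjoint_singleton_left.2 heF) (var2083_det_mem e) hS
    (hmeas _) (hmeas _), prodBernoulli_real_setOf_mem]

/-- One closed pair in front of an independent event: `P({e ∉ ω} ∩ S) = (1 − v e) · P(S)`. [folklore] -/
theorem real_notMem_inter (v : Sym2 (Fin n) → unitInterval) (e : Sym2 (Fin n)) {F : Finset (Sym2 (Fin n))} (heF : e ∉ F)
    {S : Set (BondConfig (Fin n))} (hS : DeterminedBy S (↑F : Set (Sym2 (Fin n)))) :
    (prodBernoulli v).real ({ω | e ∉ ω} ∩ S) = (1 - (v e : ℝ)) * (prodBernoulli v).real S := by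
  have hmeas : ∀ U : Set (BondConfig (Fin n)), MeasurableSet U := fun U => (Set.toFinite U).measurableSet
  rw [prodBernoulli_real_inter_of_determinedBy_disjoint v (Finset.disjoint_singleton_left.2 heF) (var2083_det_notMem e) hS
    (hmeas _) (hmeas _), prodBernoulli_real_setOf_notMem]

/-- A pair of weight `0` is almost surely closed: events agreeing on `{e ∉ ω}` have the same probability. [folklore] -/
theorem real_congr_of_null (v : Sym2 (Fin n) → unitInterval) {e : Sym2 (Fin n)} (he : (v e : ℝ) = 0)
    (S T : Set (BondConfig (Fin n))) (hST : ∀ ω : BondConfig (Fin n), e ∉ ω → (ω ∈ S ↔ ω ∈ T)) :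
    (prodBernoulli v).real S = (prodBernoulli v).real T := by
  set μ := prodBernoulli v with hμ
  have hmeas : ∀ U : Set (BondConfig (Fin n)), MeasurableSet U := fun U => (Set.toFinite U).measurableSet
  have hN0 : μ.real {ω | e ∈ ω} = 0 := by rw [hμ, prodBernoulli_real_setOf_mem]; exact he
  have hsplit : ∀ U : Set (BondConfig (Fin n)), μ.real U = μ.real (U \ {ω | e ∈ ω}) := by
    intro U
    have h := measureReal_inter_add_sdiff (μ := μ) (s := U) (hmeas {ω | e ∈ ω})
    have h0 : μ.real (U ∩ {ω | e ∈ ω}) = 0 :=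
      le_antisymm ((measureReal_mono Set.inter_subset_right).trans hN0.le) measureReal_nonneg
    linarith
  have hdiff : S \ {ω | e ∈ ω} = T \ {ω | e ∈ ω} := by
    ext ω
    simp only [Set.mem_sdiff, mem_setOf_eq]
    constructor
    · rintro ⟨hS, hω⟩; exact ⟨(hST ω hω).1 hS, hω⟩
    · rintro ⟨hT, hω⟩; exact ⟨(hST ω hω).2 hT, hω⟩
  rw [hsplit S, hsplit T, hdiff]

/-! ## The law of the number of open leaf pairs -/

section Leaves

variable (v : Sym2 (Fin n) → unitInterval) (u : Fin n)

/-- Adding a leaf: `K_{insert a L} = K_L + 𝟙[s(u,a) open]`. [this work] -/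
theorem count_insert {a : Fin n} {L : Finset (Fin n)} (ha : a ∉ L) (ω : BondConfig (Fin n)) :
    ((insert a L).filter fun ℓ => s(u, ℓ) ∈ ω).card = (L.filter fun ℓ => s(u, ℓ) ∈ ω).card + (if s(u, a) ∈ ω then 1 else 0) := by
  rw [filter_insert]
  by_cases h : s(u, a) ∈ ω
  · rw [if_pos h, if_pos h, card_insert_of_notMem (fun h' => ha (mem_of_mem_filter a h'))]
  · rw [if_neg h, if_neg h, add_zero]

/-- The leaf count over `L` is determined by the leaf pairs of `L`. [this work] -/
theorem determinedBy_count (L : Finset (Fin n)) (P : ℕ → Prop) :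
    DeterminedBy {ω : BondConfig (Fin n) | P (L.filter fun ℓ => s(u, ℓ) ∈ ω).card} (↑(L.image fun ℓ => s(u, ℓ)) : Set (Sym2 (Fin n))) := by
  refine determinedBy_of_mem_iff fun ω ω' h => ?_
  have : (L.filter fun ℓ => s(u, ℓ) ∈ ω) = (L.filter fun ℓ => s(u, ℓ) ∈ ω') :=
    filter_congr fun ℓ hℓ => h _ (mem_image_of_mem _ hℓ)
  simp only [mem_setOf_eq, this]

/-- A fresh leaf pair is not among the leaf pairs of `L` (`u ∉ insert a L`). [this work] -/
theorem leafPair_notMem_image {a : Fin n} {L : Finset (Fin n)} (ha : a ∉ L) (hu : u ≠ a) :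
    s(u, a) ∉ L.image fun ℓ => s(u, ℓ) := by
  intro h
  obtain ⟨ℓ, hℓ, he⟩ := mem_image.1 h
  rcases Sym2.eq_iff.1 he with ⟨-, h2⟩ | ⟨h1, -⟩
  · exact ha (h2 ▸ hℓ)
  · exact hu h1

/-- **`P(K_L = 0) = z0 L q`** with `q ℓ = v s(u,ℓ)`, for `u ∉ L`. [this work] -/
theorem real_count_zero_eq (L : Finset (Fin n)) (huL : u ∉ L) :
    (prodBernoulli v).real {ω : BondConfig (Fin n) | (L.filter fun ℓ => s(u, ℓ) ∈ ω).card = 0} =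
      z0 L (fun ℓ => (v s(u, ℓ) : ℝ)) := by
  induction L using Finset.induction_on with
  | empty => simp [z0]
  | insert a L ha ih =>
    have hua : u ≠ a := fun h => huL (h ▸ mem_insert_self a L)
    have huL' : u ∉ L := fun h => huL (mem_insert_of_mem h)
    have hset : {ω : BondConfig (Fin n) | ((insert a L).filter fun ℓ => s(u, ℓ) ∈ ω).card = 0} =
        {ω | s(u, a) ∉ ω} ∩ {ω | (L.filter fun ℓ => s(u, ℓ) ∈ ω).card = 0} := by
      ext ω
      simp only [mem_setOf_eq, Set.mem_inter_iff, count_insert u ha ω]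
      by_cases h : s(u, a) ∈ ω
      · simp [h]
      · simp [h]
    rw [hset, real_notMem_inter v _ (leafPair_notMem_image u ha hua) (determinedBy_count u L fun k => k = 0), ih huL',
      z0_insert ha]

/-- **`P(K_L = 1) = z1 L q`** with `q ℓ = v s(u,ℓ)`, for `u ∉ L`. [this work] -/
theorem real_count_one_eq (L : Finset (Fin n)) (huL : u ∉ L) :
    (prodBernoulli v).real {ω : BondConfig (Fin n) | (L.filter fun ℓ => s(u, ℓ) ∈ ω).card = 1} =
      z1 L (fun ℓ => (v s(u, ℓ) : ℝ)) := by
  have hmeas : ∀ U : Set (BondConfig (Fin n)), MeasurableSet U := fun U => (Set.toFinite U).measurableSet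
  induction L using Finset.induction_on with
  | empty =>
    have : {ω : BondConfig (Fin n) | ((∅ : Finset (Fin n)).filter fun ℓ => s(u, ℓ) ∈ ω).card = 1} = ∅ := by
      ext ω; simp
    rw [this, measureReal_empty, z1_empty]
  | insert a L ha ih =>
    have hua : u ≠ a := fun h => huL (h ▸ mem_insert_self a L)
    have huL' : u ∉ L := fun h => huL (mem_insert_of_mem h)
    have hset : {ω : BondConfig (Fin n) | ((insert a L).filter fun ℓ => s(u, ℓ) ∈ ω).card = 1} =
        ({ω | s(u, a) ∈ ω} ∩ {ω | (L.filter fun ℓ => s(u, ℓ) ∈ ω).card = 0}) ∪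
          ({ω | s(u, a) ∉ ω} ∩ {ω | (L.filter fun ℓ => s(u, ℓ) ∈ ω).card = 1}) := by
      ext ω
      simp only [mem_setOf_eq, Set.mem_union, Set.mem_inter_iff, count_insert u ha ω]
      by_cases h : s(u, a) ∈ ω
      · simp [h]
      · simp [h]
    have hdisj : Disjoint ({ω : BondConfig (Fin n) | s(u, a) ∈ ω} ∩ {ω | (L.filter fun ℓ => s(u, ℓ) ∈ ω).card = 0})
        ({ω | s(u, a) ∉ ω} ∩ {ω | (L.filter fun ℓ => s(u, ℓ) ∈ ω).card = 1}) := by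
      rw [Set.disjoint_left]
      rintro ω ⟨h1, -⟩ ⟨h2, -⟩
      exact h2 h1
    rw [hset, measureReal_union hdisj (hmeas _),
      real_mem_inter v _ (leafPair_notMem_image u ha hua) (determinedBy_count u L fun k => k = 0),
      real_notMem_inter v _ (leafPair_notMem_image u ha hua) (determinedBy_count u L fun k => k = 1),
      real_count_zero_eq v u L huL', ih huL', z1_insert ha]

/-- `P(K_L ≥ 1) = 1 − z0`. [this work] -/
theorem real_count_ge_one_eq (L : Finset (Fin n)) (huL : u ∉ L) :
    (prodBernoulli v).real {ω : BondConfig (Fin n) | 1 ≤ (L.filter fun ℓ => s(u, ℓ) ∈ ω).card} =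
      1 - z0 L (fun ℓ => (v s(u, ℓ) : ℝ)) := by
  have hmeas : ∀ U : Set (BondConfig (Fin n)), MeasurableSet U := fun U => (Set.toFinite U).measurableSet
  have hc : {ω : BondConfig (Fin n) | 1 ≤ (L.filter fun ℓ => s(u, ℓ) ∈ ω).card} =
      {ω : BondConfig (Fin n) | (L.filter fun ℓ => s(u, ℓ) ∈ ω).card = 0}ᶜ := by
    ext ω; simp only [mem_setOf_eq, Set.mem_compl_iff]; omega
  rw [hc, probReal_compl_eq_one_sub (hmeas _), real_count_zero_eq v u L huL]

/-- `P(K_L ≥ 2) = 1 − z0 − z1`. [this work] -/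
theorem real_count_ge_two_eq (L : Finset (Fin n)) (huL : u ∉ L) :
    (prodBernoulli v).real {ω : BondConfig (Fin n) | 2 ≤ (L.filter fun ℓ => s(u, ℓ) ∈ ω).card} =
      1 - z0 L (fun ℓ => (v s(u, ℓ) : ℝ)) - z1 L (fun ℓ => (v s(u, ℓ) : ℝ)) := by
  have hmeas : ∀ U : Set (BondConfig (Fin n)), MeasurableSet U := fun U => (Set.toFinite U).measurableSet
  have hc : {ω : BondConfig (Fin n) | 2 ≤ (L.filter fun ℓ => s(u, ℓ) ∈ ω).card} =
      ({ω : BondConfig (Fin n) | (L.filter fun ℓ => s(u, ℓ) ∈ ω).card = 0} ∪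
        {ω : BondConfig (Fin n) | (L.filter fun ℓ => s(u, ℓ) ∈ ω).card = 1})ᶜ := by
    ext ω; simp only [mem_setOf_eq, Set.mem_compl_iff, Set.mem_union]; omega
  have hdisj : Disjoint {ω : BondConfig (Fin n) | (L.filter fun ℓ => s(u, ℓ) ∈ ω).card = 0}
      {ω : BondConfig (Fin n) | (L.filter fun ℓ => s(u, ℓ) ∈ ω).card = 1} := by
    rw [Set.disjoint_left]; intro ω h0 h1
    simp only [mem_setOf_eq] at h0 h1; omega
  rw [hc, probReal_compl_eq_one_sub (hmeas _), measureReal_union hdisj (hmeas _), real_count_zero_eq v u L huL,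
    real_count_one_eq v u L huL]
  ring

end Leaves

end Bundle

end Quant

end Summit.CriticalPhenomena.PercolationContinuityZ3.Theorems
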